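import Summits.BirchSwinnertonDyer.Rank1Residual.X5.TwoAdicMuZeroUpgrade
import Summits.BirchSwinnertonDyer.Rank1Residual.X5.TwoAdicTargetsAlpha
import Summits.BirchSwinnertonDyer.Rank1Residual.X5.TwoAdicTargetsB
import Summits.BirchSwinnertonDyer.Rank1Residual.X5.TwoAdicTargetsLead
import Literature.NumberTheory.EllipticCurves.Greenberg1999.TwoTorsionMuInvariant
import HarnessLib

/-!
# Class O1 (X5, `p = 2`, non-CM): the α-go ASSEMBLY — the upper half at `2` on the Greenberg
# Prop. 5.14 locus (rational `2`-torsion, ramified-XOR-odd), from PRINT + KERNEL + one certificate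

HONEST FRAMING (cell `b2b-bsdres`, run/shared/lean/b2b/bsd-rank1-residual/, verbatim in every
file): the goal of the cell is to DELETE the COMBINATION-SHAPED residual classes of the
Birch–Swinnerton-Dyer formula for ALL analytic-rank `≤ 1` elliptic curves over `ℚ` — "full BSD
formula for every rank `≤ 1` curve in class `C`" assembled STRICTLY from published theorems — so
that the rank-`≤ 1` remainder becomes exactly the CONSTRUCTION-SHAPED classes, which are TYPED
(missing-input `Prop`s), NOT attempted. This is not "finishing BSD". Research routes; no claim
beyond stated classes; census output = EVIDENCE, never a Literature fact; nothing here is booked;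
no mark of RESIDUAL-MAP §I moves.

Unit `b2b-bsdres-cc-typer-4` (lane CLASS-CLOSURE, class O1), gen 3: the "α-go assembly" of the o1
class lead's prover order v2.4 (i) (`HOME/cells/o1/PLAN.md` §12.6 C37; refuter REFUTER-O1 v3 §12
L1-R3′ "STAFF-NOW, 83 classes"), landed by the typer since every slot is now in the tree:
`charIdeal_dvd_of_kato_allPrimes_of_mu_eq_zero` (`X5/TwoAdicMuZeroUpgrade.lean`, refuter), G11a′
`chainUpperAtTwo_of_divisibilityRat` / `upperBound_two_of_divisibilityRat`
(`X5/TwoAdicTargetsAlpha.lean`), Greenberg Thm. 4.1 AT `2` (`TwoAdicEulerCharRankZero W 0`, in print,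
`twoAdicEulerCharRankZero_zero_of_greenberg`), and the literature seat's Greenberg Prop. 5.14 AT `2`
named fact `Greenberg1999.prop514_isTorsion_mu_eq_zero_two` (cited-only). THEOREMS ONLY.

* **`upperBound_two_of_mu_eq_zero` (PROVED, per datum)** — good ordinary `2`, `L(E,1) ≠ 0`, GZK,
  Greenberg 4.1@2 (`hEC`), Kato 17.4 (1)(2) AT `2` for the newform (`h17 : kato_divisibility_allPrimes
  W 2`, PUBLISHED, parity-free, any image), `μ(X(E/ℚ_∞)) = 0` for the dual datum (`hμ`), and an
  INTEGRAL normalisation `ι L₀ = ϖ′ · L₂(f, α)` (`ϖ′ ∈ ℚ^×`, `ord₂ ϖ′ ≤ ord₂ ϖ + k`, `ϖ · Ω_E = Ω⁺_f`)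
  ⇒ `∃ q, #Ш_an = q ∧ ord₂ #Ш ≤ ord₂ q + k`. (μ = 0 upgrades Kato's `⊗ℚ` divisibility to `Λ`; the
  rational-normaliser chain reads it at `T = 0`.)
* **`missingUpperBoundAt_two_of_mu_eq_zero` (PROVED, per curve)** — rank `0`, good ordinary `2`,
  `μ = 0` for the cyclotomic data, integrality of the Néron-normalised `2`-adic `L`-function
  `ϖ · L₂(f, α) ∈ Λ` (`hint`: the per-curve CERTIFICATE — lens-1 / census-lead job P-α237, EVIDENCE
  per row; on `E[2]`-irreducible rows a theorem, T-INT2 + A-PER2) ⇒ `MissingUpperBoundAt W 2`, SHARP.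
* **`missingUpperBoundAt_two_of_prop514` (PROVED)** — the α-go line itself: the `μ = 0 ∧ X` torsion
  input is Greenberg Prop. 5.14 at `2` (`h514`) applied to a rational point `(x, y)` of order `2`
  (`2y + a₁x + a₃ = 0`) that is ramified-at-2 XOR odd (`Greenberg1999.TwoTorsionRamifiedAtTwo x`,
  `Greenberg1999.TwoTorsionOdd W x` — the literature seat's x-coordinate dictionary, flags
  `Gre99-C2-kernel-of-reduction`, `Gre99-Cinf-minimal-x`). REACH (refuter census
  `O1D-GREENBERG-L1.tsv`, EVIDENCE): 83 good-ordinary r0 classes of O1-D contain such a member.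
* **`bsdp_two_of_prop514_of_lowerBound` / `bsdp_two_of_mu_eq_zero_of_lowerBound` (PROVED)** — with
  the LOWER half `MissingLowerBoundAt W 2` (per pair: an exact descent certificate, instrument tier;
  per class: the Eisenstein half at `2`, `X5/TwoAdicTargetsEisenstein.lean`, NOT in print) ⇒
  `BSD(E,2)`; NO slack, NO Cassels–Tate/evenness input, NO image hypothesis, NO period-unit input.
  By E3-ISO (`bsdp_two_iff_of_isIsogenous`) it suffices to run this on ONE member `E*` per class.

END-STATE ON α-go (83 classes), by tree theorems: `BSD(E*,2)` ⟸ PUBLISHED named facts {Kato 17.4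
(1)(2)@2, Greenberg 4.1@2, Greenberg 5.14@2, modularity, GZK} + INSTRUMENT {`ϖ_{E*} · L₂(f, α) ∈ Λ`
certificate (predicted 237/237 by lens-1's `μ₂^an = m_E` law; ANOMALY protocol otherwise)} + LOWER
half {certificate per pair | Eisenstein half per class}. Nothing is booked; O1 OPEN; no mark moves.

References: [GreenbergLNM1716] Thm. 4.1 (p. 102), Props. 5.13–5.14 (pp. 120–121, chunks
p0168–p0170); [Kato2004Asterisque] Thm. 17.4 (p. 273); [GreenbergVatsal2000] p. 4; [Miller2011LMS]
Def. 1.1; [Cassels1965ArithmeticVIII] (isogeny invariance, via `bsdRHS_eq_of_isIsogenous`).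
-/

set_option autoImplicit false

noncomputable section

open scoped Classical MatrixGroups ModularForm

open CongruenceSubgroup WeierstrassCurve Literature.NumberTheory.EllipticCurves
  Literature.NumberTheory.EllipticCurves.ModularForms
  Literature.NumberTheory.EllipticCurves.Wuthrich2014
  Literature.NumberTheory.EllipticCurves.Rank1Residual
  Literature.NumberTheory.EllipticCurves.Rank1Residual.Typed
  Literature.NumberTheory.EllipticCurves.Greenberg1999

namespace Summit.BirchSwinnertonDyer.Rank1Residual.X5.O1

variable (W : WeierstrassCurve ℚ) [W.IsElliptic] [W.IsGloballyMinimal]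

/-! ## §1 Per datum: `μ = 0` + Kato 17.4 (1)(2)@2 + an integral normaliser ⇒ upper half, slack `k` -/

/-- **Upper half at `2` from `μ = 0`, per datum (PROVED).** Good ordinary `2` (`hord`),
`L(E,1) ≠ 0`, GZK (`hGZK`), Greenberg 4.1 at `2` (`hEC`, in print); Kato 17.4 (1)(2) AT `2` for the
newform `f` (`h17`, PUBLISHED, parity-free, any residual image); a dual datum `D` with `D.mu = 0`;
the period ratio `ϖ` (`ϖ · Ω_E = Ω⁺_f`) and an integral normalisation `ι L₀ = ϖ′ · L₂(f, α)`, `ϖ′ ≠ 0`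
rational with `ord₂ ϖ′ ≤ ord₂ ϖ + k`. Then `∃ q, #Ш_an = q ∧ ord₂ #Ш ≤ ord₂ q + k`. Proof: the
refuter's `charIdeal_dvd_of_kato_allPrimes_of_mu_eq_zero` gives `X` torsion and `L₀ ∈ char_Λ X`; G11a′
(`upperBound_two_of_divisibilityRat`) reads it at `T = 0`. [cite: Kato2004Asterisque, Thm. 17.4 (1)(2) (p. 273)]
[cite: GreenbergVatsal2000, p. 4 (after Thm. (1.2))] [cite: GreenbergLNM1716, Thm. 4.1 (p. 102)] -/
theorem upperBound_two_of_mu_eq_zero (hEC : TwoAdicEulerCharRankZero W 0)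
    (hGZK : rank_eq_analyticRank_of_analyticRank_le_one)
    (hord : IsOrdinaryAt W 2) (hL : W.entireLFunction 1 ≠ 0)
    {κ : ZpExtension ℚ 2} {γ : Field.absoluteGaloisGroup ℚ} {N : ℕ} [NeZero N]
    {f : CuspForm (Gamma0 N) 2} (h17 : kato_divisibility_allPrimes W 2 (f := f))
    (hκ : κ.IsCyclotomic) (hγ : κ.IsTopGenerator γ) (hγ' : IsCyclotomicVariable 2 γ)
    (hf : IsNewformOf W f) (D : W.SelmerDualData κ γ) (hμ : D.mu = 0) (ϖ : ℚ)
    (hϖ : (ϖ : ℝ) * W.realPeriodRat = plusPeriod f) {ϖ' : ℚ} (hϖ'0 : ϖ' ≠ 0) (k : ℕ)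
    (hk : padicValRat 2 ϖ' ≤ padicValRat 2 ϖ + k) {L₀ : IwasawaAlgebra 2}
    (hL₀ : iwasawaToPowerSeries 2 L₀ =
      PowerSeries.C (ϖ' : ℚ_[2]) * padicLFunction f (unitRoot W 2 : ℚ_[2])) :
    ∃ q : ℚ, shaAn W = (q : ℂ) ∧ (padicValNat 2 W.shaOrder : ℤ) ≤ padicValRat 2 q + k := by
  obtain ⟨hX, hmem⟩ :=
    MuZeroUpgrade.charIdeal_dvd_of_kato_allPrimes_of_mu_eq_zero W 2 h17 hκ hγ hγ' hord hf D hμ hL₀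
  exact upperBound_two_of_divisibilityRat W hEC hGZK hord hL hκ hγ hγ' hf D ϖ hϖ hϖ'0 k hk
    ⟨hX, L₀, hmem, hL₀⟩

/-! ## §2 Per curve: `μ = 0` for the cyclotomic data + the Néron-integrality certificate ⇒ `MissingUpperBoundAt W 2` -/

/-- **`MissingUpperBoundAt W 2` from `μ₂(X(E/ℚ_∞)) = 0` (PROVED, per curve, SHARP).** Rank `0`
(`hr`), good ordinary `2` (`hgo`); PUBLISHED inputs as hypotheses: Greenberg 4.1@2 (`hEC`),
modularity (`hmod`), GZK (`hGZK`), Kato 17.4 (1)(2)@2 for the newform at level `N_E` (`h17`); the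
research/certificate inputs: `μ = 0` for the cyclotomic data (`hμ` — on the Prop. 5.14 locus this is
PRINT, `missingUpperBoundAt_two_of_prop514`) and integrality of the NÉRON-normalised `2`-adic
`L`-function `ϖ · L₂(f, α) ∈ Λ` for the newform and every period ratio (`hint` — per-curve
certificate; EVIDENCE per row). No image hypothesis, no period-unit input, no slack.
[cite: Kato2004Asterisque, Thm. 17.4 (1)(2) (p. 273)] [cite: Miller2011LMS, Def. 1.1] -/
theorem missingUpperBoundAt_two_of_mu_eq_zero (hEC : TwoAdicEulerCharRankZero W 0)
    (hmod : nonempty_modularParametrizationData)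
    (hGZK : rank_eq_analyticRank_of_analyticRank_le_one)
    (h17 : ∀ [NeZero (W.conductorNorm ℤ)] (f : CuspForm (Gamma0 (W.conductorNorm ℤ)) 2),
      kato_divisibility_allPrimes W 2 (f := f))
    (hμ : ∀ (κ : ZpExtension ℚ 2) (γ : Field.absoluteGaloisGroup ℚ), κ.IsCyclotomic →
      κ.IsTopGenerator γ → IsCyclotomicVariable 2 γ → ∀ D : W.SelmerDualData κ γ, D.mu = 0)
    (hint : ∀ [NeZero (W.conductorNorm ℤ)] (f : CuspForm (Gamma0 (W.conductorNorm ℤ)) 2),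
      IsNewformOf W f → ∀ ϖ : ℚ, (ϖ : ℝ) * W.realPeriodRat = plusPeriod f →
        ∃ L₀ : IwasawaAlgebra 2, iwasawaToPowerSeries 2 L₀ =
          PowerSeries.C (ϖ : ℚ_[2]) * padicLFunction f (unitRoot W 2 : ℚ_[2]))
    (hr : W.analyticRank = 0) (hgo : GoodOrd W 2) : MissingUpperBoundAt W 2 := by
  have hord : IsOrdinaryAt W 2 := hgo
  haveI : NeZero (W.conductorNorm ℤ) := ⟨(W.conductorNorm_pos_holds).ne'⟩
  obtain ⟨Dm⟩ := hmod W
  have hf : IsNewformOf W Dm.f := Dm.isNewformOf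
  have hL : W.entireLFunction 1 ≠ 0 :=
    (W.analyticRank_eq_zero_iff_holds hf.hasEntireLFunction).mp hr
  obtain ⟨ϖ, hϖpos, hϖeq, -⟩ := Dm.exists_rat_mul_realPeriodRat_eq_plusPeriod
  obtain ⟨κ, hκ, γ, hγ, hγ'⟩ := exists_isCyclotomic_isTopGenerator_isCyclotomicVariable_holds 2
  obtain ⟨D⟩ := W.nonempty_selmerDualData_holds κ γ hγ
  obtain ⟨L₀, hL₀⟩ := hint Dm.f hf ϖ hϖeq
  obtain ⟨q, hq, hle⟩ := upperBound_two_of_mu_eq_zero W hEC hGZK hord hL (h17 Dm.f) hκ hγ hγ' hf D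
    (hμ κ γ hκ hγ hγ' D) ϖ hϖeq hϖpos.ne' 0 (by simp) hL₀
  exact ⟨q, hq, by simpa using hle⟩

/-- **`BSD(E,2)` from `μ = 0` and the lower half (PROVED).** `missingUpperBoundAt_two_of_mu_eq_zero`
+ `MissingLowerBoundAt W 2` (certificate per pair / Eisenstein half per class) ⇒ `MissingPPartAt W 2`
⇒ `BSDp W 2` (GZK). No slack, no Cassels–Tate input. [cite: Miller2011LMS, Def. 1.1 and §1] -/
theorem bsdp_two_of_mu_eq_zero_of_lowerBound (hEC : TwoAdicEulerCharRankZero W 0)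
    (hmod : nonempty_modularParametrizationData)
    (hGZK : rank_eq_analyticRank_of_analyticRank_le_one)
    (h17 : ∀ [NeZero (W.conductorNorm ℤ)] (f : CuspForm (Gamma0 (W.conductorNorm ℤ)) 2),
      kato_divisibility_allPrimes W 2 (f := f))
    (hμ : ∀ (κ : ZpExtension ℚ 2) (γ : Field.absoluteGaloisGroup ℚ), κ.IsCyclotomic →
      κ.IsTopGenerator γ → IsCyclotomicVariable 2 γ → ∀ D : W.SelmerDualData κ γ, D.mu = 0)
    (hint : ∀ [NeZero (W.conductorNorm ℤ)] (f : CuspForm (Gamma0 (W.conductorNorm ℤ)) 2),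
      IsNewformOf W f → ∀ ϖ : ℚ, (ϖ : ℝ) * W.realPeriodRat = plusPeriod f →
        ∃ L₀ : IwasawaAlgebra 2, iwasawaToPowerSeries 2 L₀ =
          PowerSeries.C (ϖ : ℚ_[2]) * padicLFunction f (unitRoot W 2 : ℚ_[2]))
    (hr : W.analyticRank = 0) (hgo : GoodOrd W 2) (hlow : MissingLowerBoundAt W 2) : BSDp W 2 :=
  bsdp_of_missingPPartAt W 2 hGZK (by rw [hr]; exact zero_le_one)
    (missingPPartAt_of_lower_of_upper W 2 hlow
      (missingUpperBoundAt_two_of_mu_eq_zero W hEC hmod hGZK h17 hμ hint hr hgo))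

/-! ## §3 The α-go line: Greenberg Prop. 5.14 AT `2` supplies `μ = 0 ∧ X` torsion IN PRINT -/

omit [W.IsElliptic] [W.IsGloballyMinimal] in
/-- **Prop. 5.14 at `2` on a good-ordinary-`2` curve with a ramified-XOR-odd rational point of order
`2` gives `X(E/ℚ_∞)` torsion and `μ₂ = 0` for every cyclotomic datum** (the literature seat's named
fact `prop514_isTorsion_mu_eq_zero_two`, good-ordinary branch; `GoodOrd W 2` IS its reduction
hypothesis `HasGoodReductionAtPrime 2 ∧ ¬ 2 ∣ a₂`). [cite: GreenbergLNM1716, Prop. 5.14 (chunk p0170; printed p. 121)] -/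
theorem isTorsion_and_mu_eq_zero_of_prop514 [W.IsElliptic] [W.IsGloballyMinimal]
    (h514 : prop514_isTorsion_mu_eq_zero_two) (hgo : GoodOrd W 2) {x y : ℚ}
    (hP : W.toAffine.Equation x y) (h2 : 2 * y + W.a₁ * x + W.a₃ = 0)
    (hΦ : (TwoTorsionRamifiedAtTwo x ∧ ¬ TwoTorsionOdd W x) ∨
      (TwoTorsionOdd W x ∧ ¬ TwoTorsionRamifiedAtTwo x))
    {κ : ZpExtension ℚ 2} {γ : Field.absoluteGaloisGroup ℚ} (hκ : κ.IsCyclotomic)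
    (hγ : κ.IsTopGenerator γ) (D : W.SelmerDualData κ γ) : D.IsTorsion ∧ D.mu = 0 :=
  h514 W (Or.inl hgo) x y hP h2 hΦ κ γ hκ hγ D

/-- **α-go: `MissingUpperBoundAt W 2` on the Greenberg Prop. 5.14 locus (PROVED modulo PUBLISHED
named facts and ONE certificate).** Rank `0`, good ordinary `2`, a rational point `(x, y)` of order
`2` that is ramified-at-`2` XOR odd; hypotheses = named facts IN PRINT {Greenberg 5.14@2 `h514`,
Greenberg 4.1@2 `hEC`, modularity `hmod`, GZK `hGZK`, Kato 17.4 (1)(2)@2 `h17`} + the per-curve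
Néron-integrality certificate `hint` (`ϖ · L₂(f, α) ∈ Λ`). Conclusion SHARP: `ord₂ #Ш ≤ ord₂ #Ш_an`.
The refuter's L1-R3′ α-go line (REFUTER-O1 v3 §12; 83 good-ordinary r0 residue classes contain such
a member, census `O1D-GREENBERG-L1.tsv`, EVIDENCE). [cite: GreenbergLNM1716, Prop. 5.14 (p. 121) and Thm. 4.1 (p. 102)]
[cite: Kato2004Asterisque, Thm. 17.4 (1)(2) (p. 273)] [cite: Miller2011LMS, Def. 1.1] -/
theorem missingUpperBoundAt_two_of_prop514 (h514 : prop514_isTorsion_mu_eq_zero_two)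
    (hEC : TwoAdicEulerCharRankZero W 0) (hmod : nonempty_modularParametrizationData)
    (hGZK : rank_eq_analyticRank_of_analyticRank_le_one)
    (h17 : ∀ [NeZero (W.conductorNorm ℤ)] (f : CuspForm (Gamma0 (W.conductorNorm ℤ)) 2),
      kato_divisibility_allPrimes W 2 (f := f))
    (hint : ∀ [NeZero (W.conductorNorm ℤ)] (f : CuspForm (Gamma0 (W.conductorNorm ℤ)) 2),
      IsNewformOf W f → ∀ ϖ : ℚ, (ϖ : ℝ) * W.realPeriodRat = plusPeriod f →
        ∃ L₀ : IwasawaAlgebra 2, iwasawaToPowerSeries 2 L₀ =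
          PowerSeries.C (ϖ : ℚ_[2]) * padicLFunction f (unitRoot W 2 : ℚ_[2]))
    (hr : W.analyticRank = 0) (hgo : GoodOrd W 2) {x y : ℚ} (hP : W.toAffine.Equation x y)
    (h2 : 2 * y + W.a₁ * x + W.a₃ = 0)
    (hΦ : (TwoTorsionRamifiedAtTwo x ∧ ¬ TwoTorsionOdd W x) ∨
      (TwoTorsionOdd W x ∧ ¬ TwoTorsionRamifiedAtTwo x)) : MissingUpperBoundAt W 2 :=
  missingUpperBoundAt_two_of_mu_eq_zero W hEC hmod hGZK h17
    (fun _ _ hκ hγ _ D => (isTorsion_and_mu_eq_zero_of_prop514 W h514 hgo hP h2 hΦ hκ hγ D).2)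
    hint hr hgo

/-- **α-go END-STATE per pair: `BSD(E,2)` on the Prop. 5.14 locus from the lower half (PROVED).**
`missingUpperBoundAt_two_of_prop514` + `MissingLowerBoundAt W 2` (per pair an exact `2^∞`-descent
certificate, instrument tier; per class the Eisenstein half at `2`, `X5/TwoAdicTargetsEisenstein.lean`)
⇒ `BSDp W 2`. No slack, no Cassels–Tate input, no image hypothesis, no period-unit input; one member
per isogeny class suffices (`bsdp_two_iff_of_isIsogenous`). Nothing is booked.
[cite: GreenbergLNM1716, Prop. 5.14 (p. 121)] [cite: Miller2011LMS, Def. 1.1 and §1] -/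
theorem bsdp_two_of_prop514_of_lowerBound (h514 : prop514_isTorsion_mu_eq_zero_two)
    (hEC : TwoAdicEulerCharRankZero W 0) (hmod : nonempty_modularParametrizationData)
    (hGZK : rank_eq_analyticRank_of_analyticRank_le_one)
    (h17 : ∀ [NeZero (W.conductorNorm ℤ)] (f : CuspForm (Gamma0 (W.conductorNorm ℤ)) 2),
      kato_divisibility_allPrimes W 2 (f := f))
    (hint : ∀ [NeZero (W.conductorNorm ℤ)] (f : CuspForm (Gamma0 (W.conductorNorm ℤ)) 2),
      IsNewformOf W f → ∀ ϖ : ℚ, (ϖ : ℝ) * W.realPeriodRat = plusPeriod f →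
        ∃ L₀ : IwasawaAlgebra 2, iwasawaToPowerSeries 2 L₀ =
          PowerSeries.C (ϖ : ℚ_[2]) * padicLFunction f (unitRoot W 2 : ℚ_[2]))
    (hr : W.analyticRank = 0) (hgo : GoodOrd W 2) {x y : ℚ} (hP : W.toAffine.Equation x y)
    (h2 : 2 * y + W.a₁ * x + W.a₃ = 0)
    (hΦ : (TwoTorsionRamifiedAtTwo x ∧ ¬ TwoTorsionOdd W x) ∨
      (TwoTorsionOdd W x ∧ ¬ TwoTorsionRamifiedAtTwo x))
    (hlow : MissingLowerBoundAt W 2) : BSDp W 2 :=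
  bsdp_of_missingPPartAt W 2 hGZK (by rw [hr]; exact zero_le_one)
    (missingPPartAt_of_lower_of_upper W 2 hlow
      (missingUpperBoundAt_two_of_prop514 W h514 hEC hmod hGZK h17 hint hr hgo hP h2 hΦ))

/-! ## §4 With slack: a normaliser `ϖ′` off by `2^k` and the slack-one consumer G9 -/

/-- **α-go with slack `k`** — when the certified integral normaliser is `ϖ′` with
`ord₂ ϖ′ ≤ ord₂ ϖ + k` (e.g. `ϖ′ = 2ϖ`, `k = 1`, if only `2 · L₂(E*,T)` is integral): rank `0`, good
ordinary `2`, `μ = 0` for the cyclotomic data ⇒ `∃ q, #Ш_an = q ∧ ord₂ #Ш ≤ ord₂ q + k`. At `k = 1`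
this feeds the slack-one consumer G9 (`missingPPartAt_two_of_lowerBound_of_slack_one`, with
Cassels–Tate and `ShaAnTwoAdicValEven`). [cite: Kato2004Asterisque, Thm. 17.4 (1)(2) (p. 273)]
[cite: Miller2011LMS, Def. 1.1] -/
theorem upperBoundAtTwo_of_mu_eq_zero_of_slack (hEC : TwoAdicEulerCharRankZero W 0)
    (hmod : nonempty_modularParametrizationData)
    (hGZK : rank_eq_analyticRank_of_analyticRank_le_one) (k : ℕ)
    (h17 : ∀ [NeZero (W.conductorNorm ℤ)] (f : CuspForm (Gamma0 (W.conductorNorm ℤ)) 2),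
      kato_divisibility_allPrimes W 2 (f := f))
    (hμ : ∀ (κ : ZpExtension ℚ 2) (γ : Field.absoluteGaloisGroup ℚ), κ.IsCyclotomic →
      κ.IsTopGenerator γ → IsCyclotomicVariable 2 γ → ∀ D : W.SelmerDualData κ γ, D.mu = 0)
    (hint : ∀ [NeZero (W.conductorNorm ℤ)] (f : CuspForm (Gamma0 (W.conductorNorm ℤ)) 2),
      IsNewformOf W f → ∀ ϖ : ℚ, (ϖ : ℝ) * W.realPeriodRat = plusPeriod f →
        ∃ (ϖ' : ℚ) (L₀ : IwasawaAlgebra 2), ϖ' ≠ 0 ∧ padicValRat 2 ϖ' ≤ padicValRat 2 ϖ + k ∧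
          iwasawaToPowerSeries 2 L₀ =
            PowerSeries.C (ϖ' : ℚ_[2]) * padicLFunction f (unitRoot W 2 : ℚ_[2]))
    (hr : W.analyticRank = 0) (hgo : GoodOrd W 2) :
    ∃ q : ℚ, shaAn W = (q : ℂ) ∧ (padicValNat 2 W.shaOrder : ℤ) ≤ padicValRat 2 q + k := by
  have hord : IsOrdinaryAt W 2 := hgo
  haveI : NeZero (W.conductorNorm ℤ) := ⟨(W.conductorNorm_pos_holds).ne'⟩
  obtain ⟨Dm⟩ := hmod W
  have hf : IsNewformOf W Dm.f := Dm.isNewformOf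
  have hL : W.entireLFunction 1 ≠ 0 :=
    (W.analyticRank_eq_zero_iff_holds hf.hasEntireLFunction).mp hr
  obtain ⟨ϖ, -, hϖeq, -⟩ := Dm.exists_rat_mul_realPeriodRat_eq_plusPeriod
  obtain ⟨κ, hκ, γ, hγ, hγ'⟩ := exists_isCyclotomic_isTopGenerator_isCyclotomicVariable_holds 2
  obtain ⟨D⟩ := W.nonempty_selmerDualData_holds κ γ hγ
  obtain ⟨ϖ', L₀, hϖ'0, hk, hL₀⟩ := hint Dm.f hf ϖ hϖeq
  exact upperBound_two_of_mu_eq_zero W hEC hGZK hord hL (h17 Dm.f) hκ hγ hγ' hf D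
    (hμ κ γ hκ hγ hγ' D) ϖ hϖeq hϖ'0 k hk hL₀

/-- **α-go at slack one ⇒ `BSD(E,2)` via G9** (Cassels–Tate `hCT` + evenness of `ord₂ #Ш_an` from a
rank-`0` certificate `heven` + the lower half `hlow`). [cite: Miller2011LMS, Def. 1.1]
[cite: SilvermanAEC2009, Thm. X.4.14 (Cassels–Tate ⇒ #Ш square)] -/
theorem bsdp_two_of_mu_eq_zero_of_slack_one (hCT : exists_casselsTate_pairing (K := ℚ))
    (hEC : TwoAdicEulerCharRankZero W 0) (hmod : nonempty_modularParametrizationData)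
    (hGZK : rank_eq_analyticRank_of_analyticRank_le_one)
    (h17 : ∀ [NeZero (W.conductorNorm ℤ)] (f : CuspForm (Gamma0 (W.conductorNorm ℤ)) 2),
      kato_divisibility_allPrimes W 2 (f := f))
    (hμ : ∀ (κ : ZpExtension ℚ 2) (γ : Field.absoluteGaloisGroup ℚ), κ.IsCyclotomic →
      κ.IsTopGenerator γ → IsCyclotomicVariable 2 γ → ∀ D : W.SelmerDualData κ γ, D.mu = 0)
    (hint : ∀ [NeZero (W.conductorNorm ℤ)] (f : CuspForm (Gamma0 (W.conductorNorm ℤ)) 2),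
      IsNewformOf W f → ∀ ϖ : ℚ, (ϖ : ℝ) * W.realPeriodRat = plusPeriod f →
        ∃ (ϖ' : ℚ) (L₀ : IwasawaAlgebra 2), ϖ' ≠ 0 ∧ padicValRat 2 ϖ' ≤ padicValRat 2 ϖ + 1 ∧
          iwasawaToPowerSeries 2 L₀ =
            PowerSeries.C (ϖ' : ℚ_[2]) * padicLFunction f (unitRoot W 2 : ℚ_[2]))
    (hcm : ¬ W.HasCM) (hr : W.analyticRank = 0) (hgo : GoodOrd W 2)
    (heven : ShaAnTwoAdicValEven W) (hlow : MissingLowerBoundAt W 2) : BSDp W 2 := by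
  haveI : Finite W.sha := (hGZK W (by rw [hr]; exact zero_le_one)).2
  obtain ⟨q, hq, hup⟩ := upperBoundAtTwo_of_mu_eq_zero_of_slack W hEC hmod hGZK 1 h17 hμ
    (fun f hf ϖ hϖ => hint f hf ϖ hϖ) hr hgo
  have hev : Even (padicValRat 2 q) := by
    obtain ⟨q', hq', -, hev'⟩ := heven (by rw [hr]; exact zero_le_one) hcm
    have hqq : q' = q := by exact_mod_cast hq'.symm.trans hq
    subst hqq
    exact hev'
  refine bsdp_of_missingPPartAt W 2 hGZK (by rw [hr]; exact zero_le_one)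
    (missingPPartAt_two_of_lowerBound_of_slack_one W hCT hlow ⟨q, hq, hev, ?_⟩)
  simpa using hup

end Summit.BirchSwinnertonDyer.Rank1Residual.X5.O1

end
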